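import Summits.HodgeConjecture.CorCM.DecicWeil23TriplePowersHodgeOfMarkman
import Summits.HodgeConjecture.CorCM.DecicWeil23PairSingleTypeHodgeOfMarkman
import HarnessLib

/-!
# COR-CM — the Hodge conjecture for every product of copies of `E`, `B₁`, `B₂`, `B₃` — THREE CM abelian fivefolds with CM by one
# DECIC field `K ⊇ i(k)`, of `k`-signature `(2,3)` and PAIRWISE DIFFERENT types, and the CM curve of `k` — GIVEN ONLY Markman's
# hyperbolic-sixfold theorem and `3`-transitivity of `Aut(ℂ/k)` on the five embeddings over `τ` (intrinsic and family forms)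

Cell `pub-hodgecm2` (COR-CM), seat b30 gen 22 (2026-08-22); count-neutral own lane DECIC-WEIL-23PAIR, part TRIPLE.  Theorems + one
bookkeeping definition (`swT`, the optional transposition `(3 4)` of a relabeling); no named fact, no `sorry`.  HONEST FRAMING:
CONDITIONAL on the single displayed named fact `HodgeTheory.Markman2025_weilClasses_algebraic_hyperbolicSixfold` (arXiv:2502.03415
Thm 1.5.1, unrefereed); `HC_CM` is not asserted and no case of the Hodge conjecture is claimed unconditionally.

* §1 THE FRAME IN SHAPE NORMAL FORM: start from the two-type normal frame of `DecicWeil23Pair.exists_frameD` (`Φ₁ ↦ {0,1}`,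
  `Φ₂ ↦ {1,2}` or `{3,2}`), read `Φ₃` as a `2`-subset `{a₂, b₂}` of the five pairs, and relabel by a permutation `(3 4)^t ∘ permD r`
  (`exists_row_shape`, `decide`) onto one of the eight shapes `posT c` of `Census/DecicWeil23Triple` — **`exists_frameT`**.
* §2 **`hodgeConjectureFor_biproduct_comp_vec_of_markmanT`** — `K ⊇ i(k)` a CM field of degree `10`, `k` imaginary quadratic,
  `B_l ⊨ (K; Φ_l)` (`l = 1, 2, 3`) with two members over `τ` each (`k`-signature `(2,3)`: CM abelian FIVEFOLDS) and `Φ₁, Φ₂, Φ₃`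
  PAIRWISE DISTINCT, `E ⊨ (k; Ψ ∋ τ)`, `Aut(ℂ/k)` `3`-TRANSITIVE on the five embeddings of `K` over `τ` (totally real quintic with
  Galois group `A₅` or `S₅`): for every `κ : Fin N → Fin 4` the Hodge conjecture holds for `⨁_j ![E, B₁, B₂, B₃](κ j)`; with the
  `AVDominatedBy` form and **the FAMILY forms** `hodgeConjectureFor_of_avDominatedBy_family_of_markmanT` (three distinct values)
  and `hodgeConjectureFor_of_avDominatedBy_family_le₃_of_markmanT` (NO distinctness: any finite family of CM fivefolds over `K`
  whose types, all of `k`-signature `(2,3)`, take AT MOST THREE values — one value via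
  `DecicWeil23Pair.hodgeConjectureFor_of_avDominatedBy_family₁_of_markmanD`, two via `…family_of_markmanD`), times `E^a`, and
  everything dominated.
THREE is the sharp uniform bound of the method: by the exact census (`Census/DecicWeil23Pair` docstring) four distinct `(2,3)`-types
carry exceptional Hodge classes outside the Weil sixfold/tenfold span on the `25` «triangle + complement» configurations.
[cite: Markman2025SecantWeil, Thm 1.5.1] [cite: Pohlmann1968, Thm 1] [cite: Shimura1998, §18.2 Lemma (i) and §6.1 Thm. 2 Cor.]
[cite: Deligne1982HodgeCycles, §5 (c)] [cite: Schoen1998HodgeWeilAddendum, §10] [cite: DixonMortimer1996, Thm 7.6A]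

## References
* [Markman2025SecantWeil] E. Markman, arXiv:2502.03415 (unrefereed), Thm 1.5.1.  [Pohlmann1968] H. Pohlmann, Ann. of Math. 88
  (1968), Thm 1.  [Shimura1998] G. Shimura, *Abelian varieties with CM and modular functions*, §18.2 Lemma (i), §6.1 Thm. 2 Cor.
  [Deligne1982HodgeCycles] P. Deligne, LNM 900 (1982), §5 (c).  [Schoen1998HodgeWeilAddendum] C. Schoen, Compositio Math. 114
  (1998), §10.  [DixonMortimer1996] J. D. Dixon, B. Mortimer, *Permutation Groups*, GTM 163, Thm 7.6A.  [MumfordAV1970] §19.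
-/

noncomputable section

open CategoryTheory CategoryTheory.Limits NumberField

namespace Summit.HodgeConjecture.CorCM.DecicWeil23Triple

open Literature.AlgebraicGeometry Literature.AlgebraicGeometry.Motives Literature.AlgebraicGeometry.HodgeTheory
open Literature.AlgebraicGeometry.ComplexMultiplication (IsCMTypeRealisation)
open Literature.AlgebraicTopology.SingularHomology
open Summit.HodgeConjecture.CorCM.Census.DecicWeil23Pair (permD permD_facts inPos)
open Summit.HodgeConjecture.CorCM.Census.DecicWeil23Triple (inPosT posT)
open Summit.HodgeConjecture.CorCM.DecicWeil23Pair (exists_frameD card_filter_symm_true₅ mem_iff_of_reading₅ h3t_of_threeTransitive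
  avDominatedBy_of_cmType_eq hodgeConjectureFor_of_avDominatedBy_family₁_of_markmanD
  hodgeConjectureFor_of_avDominatedBy_family_of_markmanD)
open Summit.HodgeConjecture.CorCM.OcticCurveFourfold (exists_delta_of_mem)
open Summit.HodgeConjecture.CorCM.Domination (AVDominatedBy)
open Summit.HodgeConjecture.CorCM.AndreRiemann (sumFam avDominatedBy_prod_of_biproduct avDominatedBy_biproduct_reindex)

open scoped Classical

/-! ## §1 The frame in shape normal form -/

/-- The optional transposition `(3 4)` after a relabeling (`t = true`: apply it): with the sixty even permutations `permD r` this
reaches every permutation of the five pairs. [folklore] -/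
def swT (t : Bool) (x : Fin 5) : Fin 5 := if t then Equiv.swap (3 : Fin 5) 4 x else x

/-- `swT t` is injective. [folklore] -/
theorem swT_injective (t : Bool) : Function.Injective (swT t) := by
  cases t
  · exact fun x y h => by simpa [swT] using h
  · exact fun x y h => (Equiv.swap (3 : Fin 5) 4).injective (by simpa [swT] using h)

/-- **The shape normal form**: with the first two types at the two-type normal positions (`inPos c₂ 0 = {0,1}`, `inPos c₂ 1 = {1,2}`
or `{3,2}`) and a third `2`-subset `{a₂, b₂}` different from both, some `(3 4)^t ∘ permD r` carries all three onto a shape `posT c`.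
[folklore] -/
theorem exists_row_shape : ∀ (c₂ : Bool) (a₂ b₂ : Fin 5), a₂ ≠ b₂ →
    (¬ ∀ a : Fin 5, ((a = a₂ ∨ a = b₂) ↔ inPos c₂ 0 a = true)) → (¬ ∀ a : Fin 5, ((a = a₂ ∨ a = b₂) ↔ inPos c₂ 1 a = true)) →
    ∃ (r : Fin 60) (t : Bool) (c : Fin 8), ∀ a : Fin 5, inPos c₂ 0 a = inPosT c 0 (swT t (permD r a)) ∧
      inPos c₂ 1 a = inPosT c 1 (swT t (permD r a)) ∧ ((a = a₂ ∨ a = b₂) ↔ inPosT c 2 (swT t (permD r a)) = true) := by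
  unfold inPos inPosT posT swT permD
  decide +kernel

section Frame

variable {K : Type} [Field K] [NumberField K] {k : Type} [Field k] [NumberField k]

/-- **THE FRAME EXISTS (shape normal form).**  For `[K:ℚ] = 10`, `i : k → K`, `Hom(k, ℂ) = {τ, τ̄}`, and three PAIRWISE DISTINCT CM
types `Φ₁, Φ₂, Φ₃` of `K` with two members over `τ` each: an enumeration `e : Hom(K, ℂ) ≃ Fin 5 × Bool` with `(e s).2 = [s ∘ i = τ]`,
`e s̄ = ((e s).1, ¬(e s).2)`, reading `Φ_{m+1}` at the positions `posT c m` of one shape `c < 8`: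
`s ∈ Φ_{m+1} ⟺ (e s).2 = inPosT c m (e s).1`. [cite: Shimura1998, §18.2 Lemma (i)] -/
theorem exists_frameT (h10 : Module.finrank ℚ K = 10) (h2 : Module.finrank ℚ k = 2) (i : k →+* K) {τ : k →+* ℂ}
    (hττ : ComplexEmbedding.conjugate τ ≠ τ) (hk : ∀ σ : k →+* ℂ, σ = τ ∨ σ = ComplexEmbedding.conjugate τ)
    (Φ₁ Φ₂ Φ₃ : CMType K) (h₁ : (Finset.univ.filter fun s : K →+* ℂ => s.comp i = τ ∧ s ∈ Φ₁.1).card = 2)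
    (h₂ : (Finset.univ.filter fun s : K →+* ℂ => s.comp i = τ ∧ s ∈ Φ₂.1).card = 2)
    (h₃ : (Finset.univ.filter fun s : K →+* ℂ => s.comp i = τ ∧ s ∈ Φ₃.1).card = 2)
    (h₁₂ : Φ₁ ≠ Φ₂) (h₁₃ : Φ₁ ≠ Φ₃) (h₂₃ : Φ₂ ≠ Φ₃) :
    ∃ (e : (K →+* ℂ) ≃ Fin 5 × Bool) (c : Fin 8), (∀ s, (e s).2 = true ↔ s.comp i = τ) ∧
      (∀ s, e (ComplexEmbedding.conjugate s) = ((e s).1, !(e s).2)) ∧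
      (∀ s, s ∈ Φ₁.1 ↔ (e s).2 = inPosT c 0 (e s).1) ∧ (∀ s, s ∈ Φ₂.1 ↔ (e s).2 = inPosT c 1 (e s).1) ∧
      (∀ s, s ∈ Φ₃.1 ↔ (e s).2 = inPosT c 2 (e s).1) := by
  -- the two-type normal frame for `Φ₁, Φ₂`
  obtain ⟨e₀, c₂, he₀_sign, he₀_conj, hr₁, hr₂⟩ := exists_frameD h10 h2 i hττ hk Φ₁ Φ₂ h₁ h₂ h₁₂
  -- the positions of `Φ₃`
  set J : Finset (Fin 5) := Finset.univ.filter fun a => e₀.symm (a, true) ∈ Φ₃.1 with hJ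
  have hJcard : J.card = 2 := by rw [hJ, card_filter_symm_true₅ he₀_sign (fun s => s ∈ Φ₃.1)]; exact h₃
  have hr₃ : ∀ s, s ∈ Φ₃.1 ↔ (e₀ s).2 = decide ((e₀ s).1 ∈ J) :=
    mem_iff_of_reading₅ (Φ := Φ₃) (P := fun a => decide (a ∈ J)) he₀_conj fun a => by simp [hJ]
  obtain ⟨a₂, b₂, hab, hJeq⟩ := Finset.card_eq_two.1 hJcard
  have hmemJ : ∀ a, a ∈ J ↔ a = a₂ ∨ a = b₂ := fun a => by rw [hJeq, Finset.mem_insert, Finset.mem_singleton]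
  -- `Φ₃` differs from `Φ₁`, `Φ₂`: its positions are not theirs
  have hne : ∀ (Φ : CMType K) (P : Fin 5 → Bool), (∀ s, s ∈ Φ.1 ↔ (e₀ s).2 = P (e₀ s).1) → Φ ≠ Φ₃ →
      ¬ ∀ a : Fin 5, ((a = a₂ ∨ a = b₂) ↔ P a = true) := by
    intro Φ P hrm hneq hall
    apply hneq
    refine Subtype.ext (Set.ext fun s => ?_)
    change s ∈ Φ.1 ↔ s ∈ Φ₃.1
    rw [hrm, hr₃]
    have key : P (e₀ s).1 = decide ((e₀ s).1 ∈ J) := by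
      have h := hall (e₀ s).1
      rw [← hmemJ] at h
      cases hP : P (e₀ s).1
      · rw [hP] at h; symm; simpa using h
      · rw [hP] at h; symm; simpa using h
    rw [key]
  have hn₁ := hne Φ₁ (inPos c₂ 0) hr₁ h₁₃
  have hn₂ := hne Φ₂ (inPos c₂ 1) hr₂ h₂₃
  obtain ⟨r, t, c, hrtc⟩ := exists_row_shape c₂ a₂ b₂ hab hn₁ hn₂
  -- relabel by `σ = (3 4)^t ∘ permD r`
  let σ : Equiv.Perm (Fin 5) := Equiv.ofBijective (fun a => swT t (permD r a))
    (Finite.injective_iff_bijective.1 ((swT_injective t).comp (permD_facts.1 r)))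
  have hσ : ∀ a, σ a = swT t (permD r a) := fun _ => rfl
  let e : (K →+* ℂ) ≃ Fin 5 × Bool := e₀.trans (Equiv.prodCongr σ (Equiv.refl Bool))
  have he : ∀ s, e s = (σ (e₀ s).1, (e₀ s).2) := fun s => rfl
  have he_conj : ∀ s, e (ComplexEmbedding.conjugate s) = ((e s).1, !(e s).2) := fun s => by rw [he, he, he₀_conj]
  have hsymm : ∀ b : Fin 5, e.symm (b, true) = e₀.symm (σ.symm b, true) := fun b => rfl
  refine ⟨e, c, fun s => by rw [he]; exact he₀_sign s, he_conj, fun s => ?_, fun s => ?_, ?_⟩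
  · rw [hr₁ s, he, (hrtc _).1, hσ]
  · rw [hr₂ s, he, (hrtc _).2.1, hσ]
  · refine mem_iff_of_reading₅ (Φ := Φ₃) (P := inPosT c 2) he_conj fun b => ?_
    have h := (hrtc (σ.symm b)).2.2
    have hmem : e₀.symm (σ.symm b, true) ∈ Φ₃.1 ↔ σ.symm b ∈ J := by rw [hJ, Finset.mem_filter]; simp
    rw [hsymm, hmem, hmemJ, h, ← hσ, Equiv.apply_symm_apply]

end Frame

/-! ## §2 The intrinsic theorem and the family form -/

section Main

variable {K : Type} [Field K] [NumberField K] [IsCMField K] {k : Type} [Field k] [NumberField k] [IsCMField k] {N : ℕ}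
  {Φ₁ Φ₂ Φ₃ : CMType K} {B₁ B₂ B₃ : AbelianVariety ℂ}
  {ι₁ : 𝓞 K →+* End B₁} {θ₁ : K →+* Module.End ℂ (complexBetti B₁.X 1)}
  {ι₂ : 𝓞 K →+* End B₂} {θ₂ : K →+* Module.End ℂ (complexBetti B₂.X 1)}
  {ι₃ : 𝓞 K →+* End B₃} {θ₃ : K →+* Module.End ℂ (complexBetti B₃.X 1)}
  {Ψ : CMType k} {E : AbelianVariety ℂ} {ιE : 𝓞 k →+* End E} {θE : k →+* Module.End ℂ (complexBetti E.X 1)}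

/-- **THE HODGE CONJECTURE FOR EVERY PRODUCT OF COPIES OF `E, B₁, B₂, B₃`, GIVEN ONLY Markman's hyperbolic-sixfold theorem** —
`B_l ⊨ (K; Φ_l)` CM abelian FIVEFOLDS with CM by one field `K ⊇ i(k)` of degree `10`, of `k`-signature `(2,3)` (two members over
`τ`) and PAIRWISE DIFFERENT types, `E ⊨ (k; Ψ ∋ τ)`, and `Aut(ℂ)` `3`-TRANSITIVE on the five embeddings of `K` over `τ` (`h3T`):
for every `κ : Fin N → Fin 4`, every rational `(q,q)`-class on `⨁_j ![E, B₁, B₂, B₃] (κ j)` is algebraic.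
[cite: Markman2025SecantWeil, Thm 1.5.1] [cite: Pohlmann1968, Thm 1] [cite: Deligne1982HodgeCycles, §5 (c)]
[cite: Schoen1998HodgeWeilAddendum, §10] [cite: DixonMortimer1996, Thm 7.6A] -/
theorem hodgeConjectureFor_biproduct_comp_vec_of_markmanT
    (hM6 : Markman2025_weilClasses_algebraic_hyperbolicSixfold)
    (h10 : Module.finrank ℚ K = 10) (h2 : Module.finrank ℚ k = 2) (i : k →+* K)
    (hB₁ : IsCMTypeRealisation Φ₁ B₁ ι₁ θ₁) (hB₂ : IsCMTypeRealisation Φ₂ B₂ ι₂ θ₂) (hB₃ : IsCMTypeRealisation Φ₃ B₃ ι₃ θ₃)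
    (hE : IsCMTypeRealisation Ψ E ιE θE) {τ : k →+* ℂ} (hτΨ : τ ∈ Ψ.1)
    (h23₁ : (Finset.univ.filter fun s : K →+* ℂ => s.comp i = τ ∧ s ∈ Φ₁.1).card = 2)
    (h23₂ : (Finset.univ.filter fun s : K →+* ℂ => s.comp i = τ ∧ s ∈ Φ₂.1).card = 2)
    (h23₃ : (Finset.univ.filter fun s : K →+* ℂ => s.comp i = τ ∧ s ∈ Φ₃.1).card = 2)
    (h₁₂ : Φ₁ ≠ Φ₂) (h₁₃ : Φ₁ ≠ Φ₃) (h₂₃ : Φ₂ ≠ Φ₃)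
    (h3T : ∀ x y : Fin 3 ↪ {s : K →+* ℂ // s.comp i = τ}, ∃ ρ : ℂ ≃+* ℂ, ∀ j : Fin 3, (ρ : ℂ →+* ℂ).comp (x j).1 = (y j).1)
    (κ : Fin N → Fin 4) :
    HodgeConjectureFor (⨁ fun j => (![E, B₁, B₂, B₃] : Fin 4 → AbelianVariety ℂ) (κ j)).dim
      (⨁ fun j => (![E, B₁, B₂, B₃] : Fin 4 → AbelianVariety ℂ) (κ j)).X := by
  have hττ : ComplexEmbedding.conjugate τ ≠ τ := QuarticCM.conjugate_ne τ
  have hk : ∀ σ : k →+* ℂ, σ = τ ∨ σ = ComplexEmbedding.conjugate τ := fun σ =>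
    QuarticCM.eq_or_eq_conjugate_of_quadratic h2 τ σ
  have hΨ : ∀ σ : k →+* ℂ, σ ∈ Ψ.1 ↔ σ = τ := by
    intro σ
    rcases hk σ with rfl | rfl
    · exact ⟨fun _ => rfl, fun _ => hτΨ⟩
    · exact ⟨fun h => absurd h ((Ψ.2 τ).1 hτΨ), fun h => absurd h hττ⟩
  obtain ⟨δ₀, d, hd, hδ₀⟩ := CyclicSextic.exists_sq_eq_neg_nat_of_isTotallyComplex k h2
  obtain ⟨δ, hδ, hτ⟩ := exists_delta_of_mem h2 hd hδ₀ τ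
  obtain ⟨e, c, he_sign, he_conj, hr₁, hr₂, hr₃⟩ := exists_frameT h10 h2 i hττ hk Φ₁ Φ₂ Φ₃ h23₁ h23₂ h23₃ h₁₂ h₁₃ h₂₃
  have h3t := h3t_of_threeTransitive he_sign h3T
  let Kf : Fin 2 → Type := Fin.cons k fun _ : Fin 1 => K
  letI instF : ∀ j, Field (Kf j) := fun j =>
    Fin.cases (motive := fun j => Field (Kf j)) ‹Field k› (fun _ => ‹Field K›) j
  letI instN : ∀ j, NumberField (Kf j) := fun j =>
    Fin.cases (motive := fun j => NumberField (Kf j)) ‹NumberField k› (fun _ => ‹NumberField K›) j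
  haveI instC : ∀ j, IsCMField (Kf j) := fun j =>
    Fin.cases (motive := fun j => IsCMField (Kf j)) ‹IsCMField k› (fun _ => ‹IsCMField K›) j
  exact hodgeConjectureFor_biproduct_comp_of_frameT_of_markmanSixfold_h3t (Kf := Kf) (i₀ := 0) (i₁ := 1) (c := c)
    (A₄ := ![E, B₁, B₂, B₃])
    (Φ₄ := Fin.cons Ψ (Fin.cons Φ₁ (Fin.cons Φ₂ (Fin.cons Φ₃ finZeroElim))))
    (ι₄ := Fin.cons ιE (Fin.cons ι₁ (Fin.cons ι₂ (Fin.cons ι₃ finZeroElim))))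
    (θ₄ := Fin.cons θE (Fin.cons θ₁ (Fin.cons θ₂ (Fin.cons θ₃ finZeroElim)))) hM6 κ h10 h2 i hd hδ hτ
    (Fin.cases hE (Fin.cases hB₁ (Fin.cases hB₂ (Fin.cases hB₃ fun l => l.elim0)))) e he_sign he_conj
    (Fin.cases hr₁ (Fin.cases hr₂ (Fin.cases hr₃ fun l => l.elim0))) hΨ h3t

variable {n : ℕ} {Φ : Fin n → CMType K} {A : Fin n → AbelianVariety ℂ} {ι : ∀ j, 𝓞 K →+* End (A j)}
  {θ : ∀ j, K →+* Module.End ℂ (complexBetti (A j).X 1)}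

/-- **THE FAMILY FORM.**  `K ⊇ i(k)` ANY CM field of degree `10` over the imaginary quadratic `k`, `Aut(ℂ)` `3`-transitive on the five
embeddings of `K` over `τ`; `A_j ⊨ (K; Φ_j)` (`j < n`) CM abelian fivefolds, each `Φ_j` equal to one of THREE pairwise distinct types
`Φ_{j₁}, Φ_{j₂}, Φ_{j₃}` of `k`-signature `(2,3)` — e.g. Galois conjugates `σB` of one CM fivefold falling into three types, with any
CM structures and polarisations; `E ⊨ (k; Ψ ∋ τ)`.  Then every `C` dominated by `E^a × ⨁_j A_j` satisfies the Hodge conjecture,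
GIVEN ONLY Markman's hyperbolic-sixfold theorem. [cite: Markman2025SecantWeil, Thm 1.5.1] [cite: Shimura1998, §6.1 Thm. 2 Cor.]
[cite: MumfordAV1970, §19] -/
theorem hodgeConjectureFor_of_avDominatedBy_family_of_markmanT
    (hM6 : Markman2025_weilClasses_algebraic_hyperbolicSixfold)
    (h10 : Module.finrank ℚ K = 10) (h2 : Module.finrank ℚ k = 2) (i : k →+* K)
    (hA : ∀ j, IsCMTypeRealisation (Φ j) (A j) (ι j) (θ j)) {τ : k →+* ℂ} (j₁ j₂ j₃ : Fin n)
    (h23₁ : (Finset.univ.filter fun s : K →+* ℂ => s.comp i = τ ∧ s ∈ (Φ j₁).1).card = 2)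
    (h23₂ : (Finset.univ.filter fun s : K →+* ℂ => s.comp i = τ ∧ s ∈ (Φ j₂).1).card = 2)
    (h23₃ : (Finset.univ.filter fun s : K →+* ℂ => s.comp i = τ ∧ s ∈ (Φ j₃).1).card = 2)
    (h₁₂ : Φ j₁ ≠ Φ j₂) (h₁₃ : Φ j₁ ≠ Φ j₃) (h₂₃ : Φ j₂ ≠ Φ j₃) (hpos : ∀ j, Φ j = Φ j₁ ∨ Φ j = Φ j₂ ∨ Φ j = Φ j₃)
    (h3T : ∀ x y : Fin 3 ↪ {s : K →+* ℂ // s.comp i = τ}, ∃ ρ : ℂ ≃+* ℂ, ∀ l : Fin 3, (ρ : ℂ →+* ℂ).comp (x l).1 = (y l).1)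
    (hE : IsCMTypeRealisation Ψ E ιE θE) (hτΨ : τ ∈ Ψ.1) (a : ℕ)
    {C : AbelianVariety ℂ} (hC : AVDominatedBy C ((⨁ fun _ : Fin a => E).prod (⨁ A))) :
    HodgeConjectureFor C.dim C.X := by
  let Bv : Fin 3 → AbelianVariety ℂ := ![A j₁, A j₂, A j₃]
  have hdomB : ∀ j, ∃ m : Fin 3, AVDominatedBy (A j) (Bv m) := by
    intro j
    rcases hpos j with h | h | h
    · exact ⟨0, avDominatedBy_of_cmType_eq h (hA j) (hA j₁)⟩
    · exact ⟨1, avDominatedBy_of_cmType_eq h (hA j) (hA j₂)⟩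
    · exact ⟨2, avDominatedBy_of_cmType_eq h (hA j) (hA j₃)⟩
  choose m hm using hdomB
  let Y : Fin 4 → AbelianVariety ℂ := ![E, A j₁, A j₂, A j₃]
  have hYsucc : ∀ m : Fin 3, Y m.succ = Bv m := fun m => rfl
  have hd₁ : AVDominatedBy (⨁ fun _ : Fin a => E) (⨁ fun _ : Fin a => Y 0) :=
    AVDominatedBy.biproduct_map fun _ => AVDominatedBy.refl E
  have hd₂ : AVDominatedBy (⨁ A) (⨁ fun j => Y (m j).succ) :=
    AVDominatedBy.biproduct_map fun j => by rw [hYsucc]; exact hm j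
  have h₁₂' := avDominatedBy_prod_of_biproduct hd₁ hd₂
  let κ' : Fin a ⊕ Fin n → Fin 4 := Sum.elim (fun _ => 0) fun j => (m j).succ
  have hfam : sumFam (fun _ : Fin a => Y 0) (fun j => Y (m j).succ) = Y ∘ κ' := funext fun x => by
    cases x <;> rfl
  rw [hfam] at h₁₂'
  have hdom := avDominatedBy_biproduct_reindex finSumFinEquiv.symm h₁₂'
  exact Domination.hodgeConjectureFor_of_avDominatedBy
    (hodgeConjectureFor_biproduct_comp_vec_of_markmanT hM6 h10 h2 i (hA j₁) (hA j₂) (hA j₃) hE hτΨ h23₁ h23₂ h23₃ h₁₂ h₁₃ h₂₃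
      h3T (κ' ∘ finSumFinEquiv.symm)) (hC.trans hdom)

/-- **THE FAMILY FORM WITHOUT DISTINCTNESS: the types take AT MOST THREE values.**  `K ⊇ i(k)` ANY CM field of degree `10`
over the imaginary quadratic `k` with `Aut(ℂ)` `3`-transitive on the five embeddings over `τ`; `A_j ⊨ (K; Φ_j)` (`j < n`) CM
abelian fivefolds of `k`-signature `(2,3)` whose types all lie in `{Φ_{j₁}, Φ_{j₂}, Φ_{j₃}}` (ANY three indices, coincidences
allowed); `E ⊨ (k; Ψ ∋ τ)`.  Then every `C` dominated by `E^a × ⨁_j A_j` satisfies the Hodge conjecture, GIVEN ONLY Markman's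
hyperbolic-sixfold theorem — by cases: one value (`DecicWeil23Pair.hodgeConjectureFor_of_avDominatedBy_family₁_of_markmanD`),
two (`DecicWeil23Pair.hodgeConjectureFor_of_avDominatedBy_family_of_markmanD`), three (the previous theorem).  FOUR values can
fail (exact census: the `25` «triangle + complement» configurations carry classes outside the span of pairs, sixfold and
tenfold Weil weights). [cite: Markman2025SecantWeil, Thm 1.5.1] [cite: Shimura1998, §6.1 Thm. 2 Cor.; §6.2 Thm. 3]
[cite: MumfordAV1970, §19] -/
theorem hodgeConjectureFor_of_avDominatedBy_family_le₃_of_markmanT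
    (hM6 : Markman2025_weilClasses_algebraic_hyperbolicSixfold)
    (h10 : Module.finrank ℚ K = 10) (h2 : Module.finrank ℚ k = 2) (i : k →+* K)
    (hA : ∀ j, IsCMTypeRealisation (Φ j) (A j) (ι j) (θ j)) {τ : k →+* ℂ} (j₁ j₂ j₃ : Fin n)
    (h23₁ : (Finset.univ.filter fun s : K →+* ℂ => s.comp i = τ ∧ s ∈ (Φ j₁).1).card = 2)
    (h23₂ : (Finset.univ.filter fun s : K →+* ℂ => s.comp i = τ ∧ s ∈ (Φ j₂).1).card = 2)
    (h23₃ : (Finset.univ.filter fun s : K →+* ℂ => s.comp i = τ ∧ s ∈ (Φ j₃).1).card = 2)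
    (hpos : ∀ j, Φ j = Φ j₁ ∨ Φ j = Φ j₂ ∨ Φ j = Φ j₃)
    (h3T : ∀ x y : Fin 3 ↪ {s : K →+* ℂ // s.comp i = τ}, ∃ ρ : ℂ ≃+* ℂ, ∀ l : Fin 3, (ρ : ℂ →+* ℂ).comp (x l).1 = (y l).1)
    (hE : IsCMTypeRealisation Ψ E ιE θE) (hτΨ : τ ∈ Ψ.1) (a : ℕ)
    {C : AbelianVariety ℂ} (hC : AVDominatedBy C ((⨁ fun _ : Fin a => E).prod (⨁ A))) :
    HodgeConjectureFor C.dim C.X := by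
  by_cases h₁₂ : Φ j₁ = Φ j₂
  · by_cases h₁₃ : Φ j₁ = Φ j₃
    · -- one value
      refine hodgeConjectureFor_of_avDominatedBy_family₁_of_markmanD hM6 h10 h2 i hA j₁ h23₁ (fun j => ?_) h3T hE hτΨ a hC
      rcases hpos j with h | h | h
      exacts [h, h.trans h₁₂.symm, h.trans h₁₃.symm]
    · -- two values `Φ j₁, Φ j₃`
      refine hodgeConjectureFor_of_avDominatedBy_family_of_markmanD hM6 h10 h2 i hA j₁ j₃ h23₁ h23₃ h₁₃ (fun j => ?_) h3T
        hE hτΨ a hC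
      rcases hpos j with h | h | h
      exacts [Or.inl h, Or.inl (h.trans h₁₂.symm), Or.inr h]
  · by_cases h₁₃ : Φ j₁ = Φ j₃
    · -- two values `Φ j₁, Φ j₂`
      refine hodgeConjectureFor_of_avDominatedBy_family_of_markmanD hM6 h10 h2 i hA j₁ j₂ h23₁ h23₂ h₁₂ (fun j => ?_) h3T
        hE hτΨ a hC
      rcases hpos j with h | h | h
      exacts [Or.inl h, Or.inr h, Or.inl (h.trans h₁₃.symm)]
    · by_cases h₂₃ : Φ j₂ = Φ j₃
      · -- two values `Φ j₁, Φ j₂ = Φ j₃`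
        refine hodgeConjectureFor_of_avDominatedBy_family_of_markmanD hM6 h10 h2 i hA j₁ j₂ h23₁ h23₂ h₁₂ (fun j => ?_) h3T
          hE hτΨ a hC
        rcases hpos j with h | h | h
        exacts [Or.inl h, Or.inr h, Or.inr (h.trans h₂₃.symm)]
      · -- three distinct values
        exact hodgeConjectureFor_of_avDominatedBy_family_of_markmanT hM6 h10 h2 i hA j₁ j₂ j₃ h23₁ h23₂ h23₃ h₁₂ h₁₃ h₂₃ hpos
          h3T hE hτΨ a hC

/-- **In particular: the Hodge conjecture for `∏_j A_j` itself** whenever the `(2,3)`-types `Φ_j` take at most three values —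
e.g. `B₁ × B₂ × B₃`, the carrier of the three TENFOLD Weil classes of the `B_l × B̄_m` — GIVEN ONLY Markman's sixfold theorem.
[cite: Markman2025SecantWeil, Thm 1.5.1] [cite: MumfordAV1970, §19] -/
theorem hodgeConjectureFor_biproduct_family_le₃_of_markmanT
    (hM6 : Markman2025_weilClasses_algebraic_hyperbolicSixfold)
    (h10 : Module.finrank ℚ K = 10) (h2 : Module.finrank ℚ k = 2) (i : k →+* K)
    (hA : ∀ j, IsCMTypeRealisation (Φ j) (A j) (ι j) (θ j)) {τ : k →+* ℂ} (j₁ j₂ j₃ : Fin n)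
    (h23₁ : (Finset.univ.filter fun s : K →+* ℂ => s.comp i = τ ∧ s ∈ (Φ j₁).1).card = 2)
    (h23₂ : (Finset.univ.filter fun s : K →+* ℂ => s.comp i = τ ∧ s ∈ (Φ j₂).1).card = 2)
    (h23₃ : (Finset.univ.filter fun s : K →+* ℂ => s.comp i = τ ∧ s ∈ (Φ j₃).1).card = 2)
    (hpos : ∀ j, Φ j = Φ j₁ ∨ Φ j = Φ j₂ ∨ Φ j = Φ j₃)
    (h3T : ∀ x y : Fin 3 ↪ {s : K →+* ℂ // s.comp i = τ}, ∃ ρ : ℂ ≃+* ℂ, ∀ l : Fin 3, (ρ : ℂ →+* ℂ).comp (x l).1 = (y l).1)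
    (hE : IsCMTypeRealisation Ψ E ιE θE) (hτΨ : τ ∈ Ψ.1) :
    HodgeConjectureFor (⨁ A).dim (⨁ A).X :=
  hodgeConjectureFor_of_avDominatedBy_family_le₃_of_markmanT hM6 h10 h2 i hA j₁ j₂ j₃ h23₁ h23₂ h23₃ hpos h3T hE hτΨ 0
    (C := ⨁ A) ⟨AbelianVariety.prodLift 0 (𝟙 _), AbelianVariety.snd _ _, 1, one_ne_zero, by
      rw [AbelianVariety.prodLift_snd, one_smul]⟩

end Main

end Summit.HodgeConjecture.CorCM.DecicWeil23Triple

end
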